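import Summits.QuantumFields.YangMills.Theorems.UnitScaleTiltProp8FlatPortKernelRowsL0
import HarnessLib

/-!
# Route `UnitScaleTilt`, crux K1 child «MinimiserStabilityRegPr» (stmt-QuantumFields-19200), stub H `stub_halvingStep`, the (165)-A₁ row's dressing letter `C_E`:
# **THE TRANSPOSED (FINE-BOND) COLUMN SUM OF THE (X2) CHAIN AT THE PORT DISTANCE** — `Σ_b (w₃(b))⁻¹·e^{−αδ₀(d_T(y(b), βc) + 3)} ≤ 3·η⁻³·K261` at every index bond `c`
# of every charted family `domT hN D hk` (odd `L ≥ 5`, `k = K − n ≥ 1`): LEVEL-FREE volume count `≤ 3·L^{3j}` fine bonds per `j`-block against `(Lʲη)⁻³`, then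
# [Balaban1984PropagatorsII] Lemma 2.1 (2.61) over the carrier blocks — the displayed row `hcol`∕`ColSum` of `…FlatHCurlCurlPairing.curlCurlPairing_of_row2` ((X2-CH), this seat)
# and of ★w8-19200 g0's (X2-H) column letter

Cell `ym3-torus` (HUMAN RULING D-0037, YM ladder rung R3), width seat `ym-ust-19936-w3` gen 4 (★★OWNER ym3-torus-plan g26 ASSIGNMENTS 10 (b)∕11∕14 (5); ★w8-19200 g0
05:37:26Z «the CONCRETE half … exactly your (X1)-concrete objects»).  `--supports stmt-QuantumFields-19200 --as helper`; count-neutral; def-free.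
Serves item 19936 `HistoryTailL` only through its (T) row (T8 ⇐ {H, EX}).

WHAT IS PROVED (sorry-free; axioms standard; no definition).  At the d = 3 carrier `F = ⟨ℓ+1, hL, m, hm⟩`, a torus family `D : TDomains 2 ℓ M_h (K−n) P′ R` charted by `hN`:
* §1 `card_fiber_blkV1_le` — the fine bonds `b` whose carrier block `y(b) = blkV1 hN D b` is a given block `y = (j, ȳ)` number at most `3·(Lʲ)³` (injection
  `b ↦ (labels of b₋, direction)` into the cube `Π_μ [Lʲȳ_μ, Lʲȳ_μ + Lʲ) × {directions}`, `B6Geom246MultiLevelBoxL0.coord_bounds`);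
  ★ **`sum_fiber_blkV1_inv_w3_le`** — for P2 weights `w` (`IsLevWeight`): `Σ_{b : y(b) = y} (w 3 b)⁻¹ ≤ 3·(L^{K−n})³` — LEVEL-FREE (`w₃ = (Lʲη)³` on the fibre,
  `FlatPortDistanceL0.levOf_domT`);
* §2 ★★ **`colSum_domT`** — `∀ c, Σ_b (w 3 b)⁻¹·exp(−(αδ₀·(d_T(y(b), β c) + 3))) ≤ 3·(L^{K−n})³·K261 N₀ 3 L 1 (αδ₀)` under `lemma21_torus`'s binders (`M_h ≥ 1`, `P′ ≥ 1`,
  `N₀ + 1 ≤ R·L·M_h`, the (2.59)-shape threshold at rate `αδ₀`) — drop the `+3`, sum fibrewise over the blocks, (2.61) in the symmetric graph distance `d_T`.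
This is the row `hcol : ∀ c, Σ_b (w 3 b)⁻¹·exp(−(δ′·dBI b c)) ≤ K₀·u c` of `curlCurlPairing_of_row2` at `dBI := d_T + 3`, `δ′ := αδ₀`, `u ≡ 1`, `K₀ := 3·η⁻³·K261` — so with
the weight of record `u(c) = η⁻³(L^{j(c)}η)⁻¹ ≥ η⁻³` as well.  The (X2-CH) assembly at every `Adm22` datum is the companion file `…FlatPortCurlCurlPairingL0`.
HONEST SCOPE: a volume count and bookkeeping over landed certificates; NOT a claim about the mass gap.  YM₃ on the three-torus is rung R3 of the programme, not the Clay problem.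

References: T. Bałaban, CMP **96** (1984) 223–250 [Balaban1984PropagatorsII] (2.1)–(2.4) p.224, (2.45)–(2.46) p.231, Lemma 2.1 (2.59)–(2.61) pp.233–234; CMP **102** (1985)
277–309 [Balaban1985Variational] (88) p.291, (161)–(163) p.303.
-/

set_option autoImplicit false

noncomputable section

open scoped BigOperators

namespace Summit.QuantumFields.YangMills.Theorems.FlatPortColumnSumL0

open Literature.MathematicalPhysics.QuantumFieldTheory.Balaban1983to89
open B6MultiLevelBoxOperator (N0)
open B6MultiLevelTorusOperatorL0 (TDomains)
open B6Geom246MultiLevelBoxL0 (bset blkOf coord_bounds lev_eq_of_blkOf_eq)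
open B6Geom246MultiLevelTorusL0 (geomT bondT lemma21_torus)
open B6GlobalChartV1 (PV toBox toBox_apply toBox_injective)
open B6GlobalChartV1L0 (blkV1 domT)
open B6Ineq2142KLevelV1L0 (β)
open B6Ineq261LevelGap (K261 K261_nonneg)
open B6SectAOperatorsV1 (BondIdx)
open B11Eq115Space (levOf)
open T3ContinuumYM3Torus (T3Family)
open FlatCubeOpsText (IsLevWeight)
open FlatPortDistanceL0 (levOf_domT)

/-- `1 ≤ 3` (named once; every `domT`/`PV` below carries the same proof term). [folklore] -/
private theorem hd3 : 1 ≤ 2 + 1 := by norm_num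

section Carrier

variable (ℓ : ℕ) (hL : Odd (ℓ + 1) ∧ 1 < ℓ + 1) (m : ℕ) (hm : 1 ≤ m) (n K : ℕ)
variable {Mh R : ℕ} {P' : Fin (2 + 1) → ℕ}
variable (hN : ∀ μ, N0 ℓ Mh (K - n) P' μ = (PV 2 ℓ m K hd3 hL).sitesPerDir 0) (D : TDomains 2 ℓ Mh (K - n) P' R) (hk : K - n ≤ m + K)

/-! ## §1 The fibres of the block map: at most `3·L^{3j}` fine bonds per `j`-block; `Σ (w₃)⁻¹ ≤ 3η⁻³` -/

/-- **AT MOST `3·(Lʲ)³` FINE BONDS PER `j`-BLOCK**: the bonds `b` with `blkV1 hN D b = y`, `y = (j, ȳ)`, inject by `b ↦ (labels of b₋, direction)` into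
`Π_μ [Lʲȳ_μ, Lʲȳ_μ + Lʲ) × Fin 3`. [cite: Balaban1984PropagatorsII, (2.1) p.224, (2.45) p.231] -/
theorem card_fiber_blkV1_le (y : ↥(bset D.toDomains)) :
    ((Finset.univ.filter fun b : PBond (PV 2 ℓ m K hd3 hL) 0 => blkV1 hN D b = y).card : ℝ) ≤ 3 * ((((ℓ + 1) ^ y.1.1 : ℕ) : ℝ)) ^ 3 := by
  classical
  set Lj : ℤ := (((ℓ + 1) ^ y.1.1 : ℕ) : ℤ) with hLj
  set B : Finset ((Fin (2 + 1) → ℤ) × Fin (2 + 1)) :=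
    (Fintype.piFinset fun μ : Fin (2 + 1) => Finset.Ico (Lj * y.1.2 μ) (Lj * y.1.2 μ + Lj)) ×ˢ Finset.univ with hB
  set S := Finset.univ.filter fun b : PBond (PV 2 ℓ m K hd3 hL) 0 => blkV1 hN D b = y with hS
  have hmaps : Set.MapsTo (fun b : PBond (PV 2 ℓ m K hd3 hL) 0 => ((toBox hN b.src : Fin (2 + 1) → ℤ), b.dir)) ↑S ↑B := by
    intro b hb
    have hb' : blkV1 hN D b = y := (Finset.mem_filter.1 hb).2
    simp only [hB, Finset.coe_product, Set.mem_prod, Finset.mem_coe, Fintype.mem_piFinset, Finset.mem_Ico, Finset.mem_univ, and_true]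
    intro μ
    exact coord_bounds D.toDomains hb' μ
  have hinj : Set.InjOn (fun b : PBond (PV 2 ℓ m K hd3 hL) 0 => ((toBox hN b.src : Fin (2 + 1) → ℤ), b.dir)) ↑S := by
    intro b _ b' _ h
    simp only [Prod.mk.injEq] at h
    obtain ⟨h1, h2⟩ := h
    have hsrc : b.src = b'.src := toBox_injective hN (Subtype.ext h1)
    cases b
    cases b'
    simp only at hsrc h2
    subst hsrc
    subst h2
    rfl
  have hcard : S.card ≤ B.card := Finset.card_le_card_of_injOn _ hmaps hinj
  have hIco : ∀ μ : Fin (2 + 1), (Finset.Ico (Lj * y.1.2 μ) (Lj * y.1.2 μ + Lj)).card = (ℓ + 1) ^ y.1.1 := fun μ => by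
    rw [Int.card_Ico]
    have e : Lj * y.1.2 μ + Lj - Lj * y.1.2 μ = Lj := by ring
    rw [e, hLj, Int.toNat_natCast]
  have hBcard : B.card = ((ℓ + 1) ^ y.1.1) ^ 3 * 3 := by
    rw [hB, Finset.card_product, Fintype.card_piFinset, Finset.card_univ, Fintype.card_fin]
    congr 1
    rw [Finset.prod_congr rfl fun μ _ => hIco μ, Finset.prod_const, Finset.card_univ, Fintype.card_fin]
  calc ((S.card : ℕ) : ℝ) ≤ (B.card : ℝ) := by exact_mod_cast hcard
    _ = 3 * ((((ℓ + 1) ^ y.1.1 : ℕ) : ℝ)) ^ 3 := by rw [hBcard]; push_cast; ring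

/-- ★ **`Σ_{b : y(b) = y} (w₃(b))⁻¹ ≤ 3·(L^{K−n})³` — LEVEL-FREE**: on the fibre of the block `y = (j, ȳ)` the weight is `w₃ = (Lʲη)³` (`levOf_domT`, `lev_eq_of_blkOf_eq`), and the
fibre has `≤ 3·L^{3j}` bonds. [cite: Balaban1984PropagatorsII, (2.1) p.224, (2.45) p.231; Balaban1985Variational, p.286] -/
theorem sum_fiber_blkV1_inv_w3_le (w : ℕ → PBond (PV 2 ℓ m K hd3 hL) 0 → ℝ)
    (hw : IsLevWeight (⟨ℓ + 1, hL, m, hm⟩ : T3Family) n K (B6GlobalChartV1L0.domT (hd := hd3) hN D hk) w) (y : ↥(bset D.toDomains)) :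
    ∑ b ∈ Finset.univ.filter (fun b : PBond (PV 2 ℓ m K hd3 hL) 0 => blkV1 hN D b = y), (w 3 b)⁻¹ ≤ 3 * ((((ℓ + 1 : ℕ) : ℝ)) ^ (K - n)) ^ 3 := by
  classical
  set Lr : ℝ := ((ℓ + 1 : ℕ) : ℝ) with hLr
  have hL0 : (0 : ℝ) < Lr := by rw [hLr]; exact_mod_cast Nat.succ_pos ℓ
  have hFL : ((((⟨ℓ + 1, hL, m, hm⟩ : T3Family).L : ℕ) : ℝ)) = Lr := rfl
  -- the weight on the fibre
  set Ky : ℝ := ((Lr ^ y.1.1 * (Lr⁻¹) ^ (K - n)) ^ 3)⁻¹ with hKy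
  have hwb : ∀ b ∈ Finset.univ.filter (fun b : PBond (PV 2 ℓ m K hd3 hL) 0 => blkV1 hN D b = y), (w 3 b)⁻¹ = Ky := by
    intro b hb
    have hb' : blkV1 hN D b = y := (Finset.mem_filter.1 hb).2
    have hlevy : D.lev (toBox hN b.src : Fin (2 + 1) → ℤ) = y.1.1 := lev_eq_of_blkOf_eq D.toDomains hb'
    have hlev : levOf (fun j => {x : Site ((⟨ℓ + 1, hL, m, hm⟩ : T3Family).P K) 0 | (domT (hd := hd3) hN D hk).InOm j x}) (K - n) b.src = y.1.1 := by
      rw [← hlevy]; exact levOf_domT (hd := hd3) hN D hk b.src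
    rw [hw 3 b, hFL, hKy]
    exact congrArg (fun e : ℕ => ((Lr ^ e * (Lr⁻¹) ^ (K - n)) ^ 3)⁻¹) hlev
  rw [Finset.sum_congr rfl hwb, Finset.sum_const, nsmul_eq_mul]
  have hcard := card_fiber_blkV1_le ℓ hL m n K hN D y
  have hKy0 : 0 ≤ Ky := by rw [hKy]; positivity
  have hpow : ((((ℓ + 1) ^ y.1.1 : ℕ) : ℝ)) = Lr ^ y.1.1 := by rw [hLr]; push_cast; ring
  have hne : (Lr ^ y.1.1) ^ 3 ≠ 0 := pow_ne_zero _ (pow_ne_zero _ hL0.ne')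
  have hKy' : Ky = ((Lr ^ y.1.1) ^ 3)⁻¹ * (Lr ^ (K - n)) ^ 3 := by
    rw [hKy, mul_pow, mul_inv, inv_pow Lr (K - n), inv_pow (Lr ^ (K - n)) 3, inv_inv]
  calc ((Finset.univ.filter fun b : PBond (PV 2 ℓ m K hd3 hL) 0 => blkV1 hN D b = y).card : ℝ) * Ky
      ≤ (3 * ((((ℓ + 1) ^ y.1.1 : ℕ) : ℝ)) ^ 3) * Ky := mul_le_mul_of_nonneg_right hcard hKy0
    _ = 3 * (Lr ^ (K - n)) ^ 3 := by
        rw [hpow, hKy', ← mul_assoc, mul_assoc 3 ((Lr ^ y.1.1) ^ 3) (((Lr ^ y.1.1) ^ 3)⁻¹), mul_inv_cancel₀ hne, mul_one]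
    _ = 3 * ((((ℓ + 1 : ℕ) : ℝ)) ^ (K - n)) ^ 3 := by rw [hLr]

/-! ## §2 The transposed column sum at the port distance -/

/-- ★★ **THE TRANSPOSED COLUMN SUM (2.61) OVER THE FINE BONDS, AT THE PORT DISTANCE `d_T + 3`, LEVEL-FREE**:
`Σ_b (w₃(b))⁻¹·e^{−αδ₀(d_T(y(b), βc) + 3)} ≤ 3·(L^{K−n})³·K261 N₀ 3 L 1 (αδ₀)` at every index bond `c` (drop the `+3`; fibrewise over the carrier blocks with §1;
then `lemma21_torus`'s (2.61) in the symmetric graph distance). This is the row `hcol` of `…FlatHCurlCurlPairing.curlCurlPairing_of_row2` (`u ≡ 1`) and ★w8-19200 g0's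
`ColSum` of (X2-H). [cite: Balaban1984PropagatorsII, Lemma 2.1 (2.61) p.234, (2.45)-(2.46) p.231; Balaban1985Variational, (88) p.291, (161)-(163) p.303] -/
theorem colSum_domT (hMh : 1 ≤ Mh) (hP : ∀ μ, 1 ≤ P' μ) {δ₀ α : ℝ} (hδ₀ : 0 ≤ δ₀) (hα0 : 0 ≤ α) (hα1 : α ≤ 1) {N₀ : ℕ} (hN₀ : 0 < N₀)
    (hRM : N₀ + 1 ≤ R * ((ℓ + 1) * Mh)) (hθ : Real.exp (-(α * δ₀)) * ((ℓ : ℝ) + 1) ^ ((2 * (2 + 1 : ℕ) : ℝ) / N₀) < 1)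
    (w : ℕ → PBond (PV 2 ℓ m K hd3 hL) 0 → ℝ) (hw : IsLevWeight (⟨ℓ + 1, hL, m, hm⟩ : T3Family) n K (B6GlobalChartV1L0.domT (hd := hd3) hN D hk) w)
    (c : BondIdx (domT (hd := hd3) hN D hk)) :
    ∑ b : PBond (PV 2 ℓ m K hd3 hL) 0, (w 3 b)⁻¹ * Real.exp (-(α * δ₀ * (((bondT D).dist (blkV1 hN D b) (β hN D hk c) : ℝ) + 3))) ≤
      3 * ((((ℓ + 1 : ℕ) : ℝ)) ^ (K - n)) ^ 3 * K261 N₀ (2 + 1) ((ℓ : ℝ) + 1) 1 (α * δ₀) := by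
  classical
  obtain ⟨-, h261, -, -⟩ := lemma21_torus (D := D) hMh hP hN₀ hRM hδ₀ hα0 hα1 hθ
  set z := β hN D hk c with hz
  have hαδ : 0 ≤ α * δ₀ := mul_nonneg hα0 hδ₀
  set E : ↥(bset D.toDomains) → ℝ := fun y => Real.exp (-(α * δ₀ * (geomT D).dist z y)) with hE
  have hE0 : ∀ y, 0 ≤ E y := fun y => (Real.exp_pos _).le
  have hw3 : ∀ b : PBond (PV 2 ℓ m K hd3 hL) 0, 0 ≤ (w 3 b)⁻¹ := fun b => by
    rw [hw 3 b]; positivity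
  -- drop the `+3` and symmetrise the distance
  have hterm : ∀ b : PBond (PV 2 ℓ m K hd3 hL) 0,
      (w 3 b)⁻¹ * Real.exp (-(α * δ₀ * (((bondT D).dist (blkV1 hN D b) z : ℝ) + 3))) ≤ (w 3 b)⁻¹ * E (blkV1 hN D b) := by
    intro b
    refine mul_le_mul_of_nonneg_left ?_ (hw3 b)
    have hdist : (geomT D).dist z (blkV1 hN D b) = ((bondT D).dist (blkV1 hN D b) z : ℝ) := by
      show (((bondT D).dist z (blkV1 hN D b) : ℕ) : ℝ) = _
      rw [SimpleGraph.dist_comm]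
    simp only [hE]
    rw [hdist]
    exact Real.exp_le_exp.2 (neg_le_neg (mul_le_mul_of_nonneg_left (by linarith) hαδ))
  -- fibrewise over the carrier blocks
  have hfib : ∑ b : PBond (PV 2 ℓ m K hd3 hL) 0, (w 3 b)⁻¹ * E (blkV1 hN D b) =
      ∑ y : ↥(bset D.toDomains), ∑ b ∈ Finset.univ.filter (fun b : PBond (PV 2 ℓ m K hd3 hL) 0 => blkV1 hN D b = y), (w 3 b)⁻¹ * E (blkV1 hN D b) :=
    (Finset.sum_fiberwise_of_maps_to (s := Finset.univ) (t := Finset.univ) (g := fun b : PBond (PV 2 ℓ m K hd3 hL) 0 => blkV1 hN D b)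
      (fun b _ => Finset.mem_univ _) _).symm
  have hinner : ∀ y : ↥(bset D.toDomains),
      ∑ b ∈ Finset.univ.filter (fun b : PBond (PV 2 ℓ m K hd3 hL) 0 => blkV1 hN D b = y), (w 3 b)⁻¹ * E (blkV1 hN D b) ≤
        3 * ((((ℓ + 1 : ℕ) : ℝ)) ^ (K - n)) ^ 3 * E y := by
    intro y
    have hcongr : ∑ b ∈ Finset.univ.filter (fun b : PBond (PV 2 ℓ m K hd3 hL) 0 => blkV1 hN D b = y), (w 3 b)⁻¹ * E (blkV1 hN D b) =
        (∑ b ∈ Finset.univ.filter (fun b : PBond (PV 2 ℓ m K hd3 hL) 0 => blkV1 hN D b = y), (w 3 b)⁻¹) * E y := by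
      rw [Finset.sum_mul]
      refine Finset.sum_congr rfl fun b hb => ?_
      rw [(Finset.mem_filter.1 hb).2]
    rw [hcongr]
    exact mul_le_mul_of_nonneg_right (sum_fiber_blkV1_inv_w3_le ℓ hL m hm n K hN D hk w hw y) (hE0 y)
  calc ∑ b : PBond (PV 2 ℓ m K hd3 hL) 0, (w 3 b)⁻¹ * Real.exp (-(α * δ₀ * (((bondT D).dist (blkV1 hN D b) z : ℝ) + 3)))
      ≤ ∑ b : PBond (PV 2 ℓ m K hd3 hL) 0, (w 3 b)⁻¹ * E (blkV1 hN D b) := Finset.sum_le_sum fun b _ => hterm b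
    _ = ∑ y : ↥(bset D.toDomains), ∑ b ∈ Finset.univ.filter (fun b : PBond (PV 2 ℓ m K hd3 hL) 0 => blkV1 hN D b = y), (w 3 b)⁻¹ * E (blkV1 hN D b) := hfib
    _ ≤ ∑ y : ↥(bset D.toDomains), 3 * ((((ℓ + 1 : ℕ) : ℝ)) ^ (K - n)) ^ 3 * E y := Finset.sum_le_sum fun y _ => hinner y
    _ = 3 * ((((ℓ + 1 : ℕ) : ℝ)) ^ (K - n)) ^ 3 * ∑ y : ↥(bset D.toDomains), E y := by rw [Finset.mul_sum]
    _ ≤ 3 * ((((ℓ + 1 : ℕ) : ℝ)) ^ (K - n)) ^ 3 * K261 N₀ (2 + 1) ((ℓ : ℝ) + 1) 1 (α * δ₀) :=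
        mul_le_mul_of_nonneg_left (h261 z) (by positivity)

end Carrier

/-! ## §3 The dictionary line of the (X2-H) column letter: an index SITE pins `blkOf ∘ toBox` (hence `blkV1`, hence the port kernel) on its block
(appended 2026-08-28 for ★w8-19200 g0's `…ChartHInvColumnLetter` `hblk`; section-local `open`s) -/

section Dict

open B6GlobalChartV1L0 (iterBlockOf_mem_domT_iff)
open B6Ineq2142KLevelV1L0 (lev_le_of_not_deep)
open B6ScalarChartV1L0 (blkOf_toBox_eq_iff)
open B6SectAOperatorsV1 (SiteIdx)
open B5Eq118OneStroke (iterBlockOf)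

variable (ℓ : ℕ) (hL : Odd (ℓ + 1) ∧ 1 < ℓ + 1) (m : ℕ) (n K : ℕ)
variable {Mh R : ℕ} {P' : Fin (2 + 1) → ℕ}
variable (hN : ∀ μ, N0 ℓ Mh (K - n) P' μ = (PV 2 ℓ m K hd3 hL).sitesPerDir 0) (D : TDomains 2 ℓ Mh (K - n) P' R) (hk : K - n ≤ m + K)

/-- every fine site of the block `B^j(y)` of a level-`j` INDEX SITE `y ∈ Λ_j` (`y ∈ Ω_j^{(j)}`, not deep) has level exactly `j` in p21's family (`≥ j` by membership, `≤ j` by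
non-depth — the site twin of `B6Ineq2142KLevelV1L0.lev_eq_of_base`). [cite: Balaban1984PropagatorsII, (2.3)-(2.4) p.224] -/
theorem lev_toBox_eq_of_lamSite {j : ℕ} (hjk : j ≤ K - n) {y : Site (PV 2 ℓ m K hd3 hL) j}
    (hy : y ∈ (B6GlobalChartV1L0.domT (hd := hd3) hN D hk).Om j) (hyd : ¬ (domT (hd := hd3) hN D hk).Deep j y)
    {x : Site (PV 2 ℓ m K hd3 hL) 0} (hx : iterBlockOf j x = y) : D.lev (toBox hN x : Fin (2 + 1) → ℤ) = j := by
  refine le_antisymm (lev_le_of_not_deep hN D hk hyd hx) ?_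
  have h := (iterBlockOf_mem_domT_iff hN D hk hjk x).1
  rw [hx] at h
  exact h hy

/-- ★ **THE DICTIONARY LINE OF THE (X2-H) COLUMN LETTER** (★w8-19200 g0's `hblk`): two fine sites of the block of ONE index site have the same carrier block `blkOf ∘ toBox`
(so bonds issuing from them have the same `blkV1` and the same port kernel `e^{−δ(d_T(·, β i)+3)}`). [cite: Balaban1984PropagatorsII, (2.45) p.231, (2.3)-(2.4) p.224] -/
theorem blkOf_toBox_eq_of_lamSite {j : ℕ} (hjk : j ≤ K - n) {y : Site (PV 2 ℓ m K hd3 hL) j}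
    (hy : y ∈ (B6GlobalChartV1L0.domT (hd := hd3) hN D hk).Om j) (hyd : ¬ (domT (hd := hd3) hN D hk).Deep j y)
    {x x' : Site (PV 2 ℓ m K hd3 hL) 0} (hx : iterBlockOf j x = y) (hx' : iterBlockOf j x' = y) :
    blkOf D.toDomains (toBox hN x) = blkOf D.toDomains (toBox hN x') := by
  rw [blkOf_toBox_eq_iff hN D hk x' x, lev_toBox_eq_of_lamSite ℓ hL m n K hN D hk hjk hy hyd hx', hx, hx']

/-- the same for an index site `s ∈ 𝔅` of the charted family (`SiteIdx (domT hN D hk)`: `s.1.1` the level, `s.1.2` the site, `s.2 : s.1.2 ∈ Λ_{s.1.1}`).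
[cite: Balaban1984PropagatorsII, (2.3)-(2.4) p.224, (2.45) p.231] -/
theorem blkOf_toBox_eq_of_siteIdx (s : SiteIdx (B6GlobalChartV1L0.domT (hd := hd3) hN D hk)) {x x' : Site (PV 2 ℓ m K hd3 hL) 0}
    (hx : iterBlockOf (s.1.1 : ℕ) x = s.1.2) (hx' : iterBlockOf (s.1.1 : ℕ) x' = s.1.2) :
    blkOf D.toDomains (toBox hN x) = blkOf D.toDomains (toBox hN x') :=
  blkOf_toBox_eq_of_lamSite ℓ hL m n K hN D hk (Nat.lt_succ_iff.1 s.1.1.isLt) s.2.1 s.2.2 hx hx'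

/-- hence `blkV1` agrees on bonds issuing from the block of one index site. [cite: Balaban1984PropagatorsII, (2.45) p.231] -/
theorem blkV1_eq_of_siteIdx (s : SiteIdx (B6GlobalChartV1L0.domT (hd := hd3) hN D hk)) {b b' : PBond (PV 2 ℓ m K hd3 hL) 0}
    (hb : iterBlockOf (s.1.1 : ℕ) b.src = s.1.2) (hb' : iterBlockOf (s.1.1 : ℕ) b'.src = s.1.2) : blkV1 hN D b = blkV1 hN D b' :=
  blkOf_toBox_eq_of_siteIdx ℓ hL m n K hN D hk s hb hb'

end Dict

end Summit.QuantumFields.YangMills.Theorems.FlatPortColumnSumL0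

end
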